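import Literature.NumberTheory.Automorphic.AdelicGroupDataCompactMeasure
import Literature.NumberTheory.Automorphic.LevelOrbitPushforward
import HarnessLib

/-!
# Automorphic measures on compact automorphic quotients: the modular hypothesis is automatic

Topic `NumberTheory/Automorphic`; namespace `Literature.NumberTheory.Automorphic`. Proof file
(theorems only: no definition, no named fact, no instance, no `sorry`); a complement to
`AdelicGroupDataCompactMeasure` (and to `AdelicUnitaryGroupMeasure`, which treats the case `A_G = 1`).

`AdelicGroupData.exists_isAutomorphicMeasure_of_compactSpace` (file `AdelicGroupDataCompactMeasure`)
constructs an automorphic measure (`IsAutomorphicMeasure`: finite, positive on non-empty open sets,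
inner regular, `G(𝔸_K)`-invariant) on a COMPACT automorphic quotient `G(𝔸_K) ⧸ (A_G · G(K))` of
an adelic group datum with discrete `G(K)` and a central retraction `θ : G(𝔸_K) →* A_G`, under the
hypothesis `hmod` that the modular function of `G(𝔸_K)¹ = ker θ` is trivial on `G(K)`. This file
removes that hypothesis: `G(K)` is a discrete subgroup of `G(𝔸_K)¹` with compact quotient
`G(𝔸_K)¹ ⧸ G(K) ≃ₜ G(𝔸_K) ⧸ (A_G · G(K))` (`exists_retraction_homeomorph`), and **a locally
compact group with a discrete cocompact subgroup is unimodular** — the tree's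
`isMulRightInvariant_of_compactSpace_quotient` (`LevelOrbitPushforward`, from `LatticeUnimodular`:
Raghunathan, *Discrete subgroups of Lie groups* (1972), Ch. I, Remark 1.9; Bekka–de la
Harpe–Valette, *Kazhdan's property (T)*, Prop. B.2.2), so `Δ_{G(𝔸_K)¹} ≡ 1`.

* `modularCharacter_eq_one_of_discrete_of_compactSpace_quotient` — `Δ_G ≡ 1` on a locally compact
  second countable Hausdorff group `G` with a discrete subgroup `Λ` such that `G ⧸ Λ` is compact
  (the modular-character form of `LevelOrbit.isMulRightInvariant_of_compactSpace_quotient`).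
* `AdelicGroupData.exists_isAutomorphicMeasure_of_compactSpace'` — the tree theorem without `hmod`,
  for ANY central retraction `θ` (so also for data with non-trivial split component `A_G` whose
  automorphic quotient `G(𝔸_K) ⧸ (A_G · G(K))` is compact, e.g. unit groups of central division
  algebras of any degree — Fujisaki's lemma — where the quaternionic conjugation trick of
  `QuaternionAlgebraAdelicMeasureProofs` is not available). The case `A_G = 1`, `θ = 1` is
  `AdelicGroupData.exists_isAutomorphicMeasure_of_center'_eq_bot` (`AdelicUnitaryGroupMeasure`,
  with the unitary groups of CM fields as application).

## References

* A. Borel, *Some finiteness properties of adele groups over number fields*, Publ. Math. IHÉS 16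
  (1963), §5 [Borel1963].
* M. S. Raghunathan, *Discrete subgroups of Lie groups*, Ergebnisse 68 (1972), Ch. I, 1.4–1.9,
  Remark 1.9 [Raghunathan1972].
* B. Bekka, P. de la Harpe, A. Valette, *Kazhdan's Property (T)* (2008), App. B, Prop. B.2.2
  [BekkaHarpeValette2008].
-/

noncomputable section

open MeasureTheory Measure Set Filter Topology
open scoped ENNReal NNReal Pointwise

namespace Literature.NumberTheory.Automorphic

universe u

/-! ### Unimodularity from a discrete cocompact subgroup, modular-character form -/

section Unimodular

variable {G : Type*} [Group G] [TopologicalSpace G] [IsTopologicalGroup G] [LocallyCompactSpace G]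
  [SecondCountableTopology G] [T2Space G]

/-- **A locally compact second countable Hausdorff group with a discrete cocompact subgroup has
trivial modular function**: `Δ_G(g) = 1` for every `g`. Every Haar measure `ν` is right invariant
(`isMulRightInvariant_of_compactSpace_quotient`: Raghunathan (1972), Ch. I, Rem. 1.9), so
`Δ(g) • ν = (· g)_* ν = ν` and `Δ(g) = 1` (evaluate on a compact neighbourhood of `1`). Printed:
Raghunathan (1972), Ch. I, Remark 1.9 (a group admitting a lattice is unimodular); Bekka–de la
Harpe–Valette (2008), Prop. B.2.2. [cite: Raghunathan1972, Ch. I Remark 1.9]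
[cite: BekkaHarpeValette2008, Prop. B.2.2] -/
theorem modularCharacter_eq_one_of_discrete_of_compactSpace_quotient (Λ : Subgroup G)
    [DiscreteTopology Λ] [CompactSpace (G ⧸ Λ)] (g : G) : modularCharacter g = 1 := by
  borelize G
  set ν : Measure G := haar
  haveI : ν.IsMulRightInvariant := LevelOrbit.isMulRightInvariant_of_compactSpace_quotient Λ ν
  have h1 : Measure.map (· * g) ν = modularCharacterFun g • ν :=
    map_right_mul_eq_modularCharacterFun_smul ν g
  rw [map_mul_right_eq_self] at h1
  obtain ⟨C, hC, hC1⟩ := exists_compact_mem_nhds (1 : G)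
  have hpos : 0 < ν C := measure_pos_of_mem_nhds ν hC1
  have htop : ν C ≠ ∞ := hC.measure_lt_top.ne
  have h2 : 1 * ν C = (modularCharacterFun g : ℝ≥0∞) * ν C := by
    rw [one_mul]
    conv_lhs => rw [h1]
    rfl
  have h3 : ((modularCharacterFun g : ℝ≥0) : ℝ≥0∞) = 1 :=
    ((ENNReal.mul_left_inj hpos.ne' htop).1 h2).symm
  change modularCharacterFun g = 1
  exact_mod_cast h3

end Unimodular

/-! ### Automorphic measures on compact automorphic quotients, without the modular hypothesis -/

namespace AdelicGroupData

variable {K : Type} [Field K] [NumberField K]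

/-- **Existence of the automorphic measure on a compact automorphic quotient** — the theorem
`exists_isAutomorphicMeasure_of_compactSpace` of `AdelicGroupDataCompactMeasure` WITHOUT its
hypothesis `hmod`. Let `𝒢` be an adelic group datum with `G(𝔸_K)` locally compact, second
countable and Hausdorff and `G(K)` discrete, `θ : G(𝔸_K) →* G(𝔸_K)` a continuous central
retraction (values in `A_G`, the identity on `A_G`, trivial on `G(K)`) with `ker θ` locally
compact, and suppose the automorphic quotient `G(𝔸_K) ⧸ (A_G · G(K))` is compact. Then it carries
an automorphic measure. Indeed `G(K)` is a discrete subgroup of `G(𝔸_K)¹ = ker θ` with compact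
quotient `G(𝔸_K)¹ ⧸ G(K) ≃ₜ G(𝔸_K) ⧸ (A_G · G(K))` (`exists_retraction_homeomorph`), so
`G(𝔸_K)¹` is unimodular (`modularCharacter_eq_one_of_discrete_of_compactSpace_quotient`) and the
modular hypothesis of the tree theorem holds. (Borel (1963), §5; Raghunathan (1972), Ch. I,
1.4–1.9.) [cite: Borel1963, §5] -/
theorem exists_isAutomorphicMeasure_of_compactSpace' (𝒢 : AdelicGroupData.{u} K)
    [LocallyCompactSpace 𝒢.Adelic] [SecondCountableTopology 𝒢.Adelic] [T2Space 𝒢.Adelic]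
    (hdisc : 𝒢.IsDiscreteRational) (θ : 𝒢.Adelic →* 𝒢.Adelic) (hθc : Continuous θ)
    (hθA : ∀ g, θ g ∈ 𝒢.center') (hθa : ∀ a ∈ 𝒢.center', θ a = a)
    (hθγ : ∀ γ ∈ 𝒢.arithmeticSubgroup, θ γ = 1) (hlc : LocallyCompactSpace θ.ker)
    [CompactSpace 𝒢.automorphicQuotient] :
    ∃ μ : Measure 𝒢.automorphicQuotient, 𝒢.IsAutomorphicMeasure μ := by
  classical
  obtain ⟨r, e, -, -, -, -, -⟩ := exists_retraction_homeomorph 𝒢 θ hθc hθA hθa hθγ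
  haveI : DiscreteTopology 𝒢.arithmeticSubgroup := hdisc
  haveI : SecondCountableTopology θ.ker := TopologicalSpace.Subtype.secondCountableTopology _
  haveI : LocallyCompactSpace θ.ker := hlc
  -- `G(K)` is discrete in `G(𝔸_K)¹`
  have hmemΓ₁ : ∀ x : θ.ker, x ∈ 𝒢.arithmeticSubgroup.subgroupOf θ.ker ↔
      (x : 𝒢.Adelic) ∈ 𝒢.arithmeticSubgroup := fun x => Subgroup.mem_subgroupOf
  haveI : DiscreteTopology (𝒢.arithmeticSubgroup.subgroupOf θ.ker) := by
    refine DiscreteTopology.of_continuous_injective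
      (f := fun x : 𝒢.arithmeticSubgroup.subgroupOf θ.ker =>
        (⟨(x : θ.ker), (hmemΓ₁ x).1 x.2⟩ : 𝒢.arithmeticSubgroup)) ?_ ?_
    · exact (continuous_subtype_val.comp continuous_subtype_val).subtype_mk _
    · intro a b hab
      have h : ((a : θ.ker) : 𝒢.Adelic) = ((b : θ.ker) : 𝒢.Adelic) :=
        congrArg (fun y : 𝒢.arithmeticSubgroup => (y : 𝒢.Adelic)) hab
      exact Subtype.ext (Subtype.ext h)
  -- `G(𝔸_K)¹ ⧸ G(K)` is compact, being homeomorphic to the automorphic quotient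
  haveI : CompactSpace (θ.ker ⧸ 𝒢.arithmeticSubgroup.subgroupOf θ.ker) := e.symm.compactSpace
  -- hence `G(𝔸_K)¹` is unimodular
  have hmod : ∀ γ (hγ : γ ∈ 𝒢.arithmeticSubgroup),
      modularCharacter (⟨γ, (MonoidHom.mem_ker).2 (hθγ γ hγ)⟩ : θ.ker) = 1 := fun γ hγ =>
    modularCharacter_eq_one_of_discrete_of_compactSpace_quotient
      (𝒢.arithmeticSubgroup.subgroupOf θ.ker) _
  exact exists_isAutomorphicMeasure_of_compactSpace 𝒢 hdisc θ hθc hθA hθa hθγ hlc hmod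

end AdelicGroupData

end Literature.NumberTheory.Automorphic
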